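import Summits.ValiantsHypothesis.ValiantsHypothesis.Theorems.BarrierLeverPartitionMinorsHitByVPSplitDoor

/-!
# Route BarrierLever — item `PartitionMinorsHitByVP` (stmt-ValiantsHypothesis-19717):
# the general split door with ADDITIVE SIZE — hierarchies of polynomial SIZE, not bounded depth

Helper file (`--supports stmt-ValiantsHypothesis-19717`; cell valiant-natproofs, rung V4, 𝒟-side door
(c); prover seat val-np-p6 gen 7). Definition-free. Closes NO item.

`SplitDoor.partitionMinor_hit_of_split` (valiant-natproofs-prover g6, p442956) glues two threshold cells
certified by arbitrary witnesses `f₁, f₂ ∈ SmallCircuits ℂ (h+h) b` into a witness in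
`SmallCircuits ℂ (h+h) (b+1)`; iterating charges `+1` on the size EXPONENT per level, so only hierarchies
of BOUNDED DEPTH stay inside a fixed `SmallCircuits ℂ (h+h) b'`. But the construction
`f = C(x₀^K) · f₁(s • x) + C(x₀^{c₀}) · f₂` has ADDITIVE cost:

* **`partitionMinor_hit_of_split_size`** — same hypotheses minus the membership ones; conclusion:
  `∃ f, deg f ≤ max (deg f₁) (deg f₂) ∧ L(f) ≤ L(f₁) + L(f₂) + 2h + 3 ∧` the layout matrix of `f` is
  nonsingular. (Proof = the p442956 proof verbatim — tropical two-block certificate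
  `TwoBlock.det_ne_zero_of_twoBlock`, rescaling `SplitDoor.complexity_rescale_le` — with explicit size
  and degree bookkeeping in place of the exponent arithmetic.)

Consequently a split HIERARCHY (binary tree of bi-threshold splits whose leaves are certified by
witnesses of degree `≤ 2h`) yields a witness of degree `≤ 2h` and size `≤ Σ_leaves L(leaf) + (#splits)·(2h+3)`:
hierarchies with polynomially many nodes — of ANY depth — stay in `SmallCircuits`. Example: the co-rank
recursion of `…ConeSplit` could peel one vertex at a time (depth `h`) instead of all at once.

WHAT THIS IS NOT: no new class by itself; nothing on crux stmt-ValiantsHypothesis-14610 or `VP ≠ VNP`.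
-/

set_option linter.dupNamespace false

namespace Summit.ValiantsHypothesis.ValiantsHypothesis.Theorems.BarrierLever.SplitDoor

open Finset
open Literature.Barriers.ValiantsHypothesis Literature.Computability.AlgebraicComplexity
open Summit.ValiantsHypothesis.ValiantsHypothesis.Theorems.BarrierLever.TwoBlock
  (det_ne_zero_of_twoBlock det_fromBlocks_of_split_ne_zero)
open Summit.ValiantsHypothesis.ValiantsHypothesis.Theorems.BarrierLever.ThresholdDoor
  (prod_ite_zpow ite_le_ite_of_sign)

/-- **General split door, additive size** (adapted from `partitionMinor_hit_of_split`, p442956: identical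
construction, explicit size/degree bookkeeping). Threshold cells `S = {i : cu < Σ_{a∈u i} λ a}`,
`T = {j : cw < Σ μ}`, bijections `e : S ≃ T`, `e' : Sᶜ ≃ Tᶜ`; if `f₁` is nonsingular on the cell `(S,T)`
and `f₂` on `(Sᶜ,Tᶜ)`, some `f` with `deg f ≤ max (deg f₁) (deg f₂)` and
`L(f) ≤ L(f₁) + L(f₂) + 2h + 3` is nonsingular on the whole layout. -/
theorem partitionMinor_hit_of_split_size (h r : ℕ) (u w : Fin r → Finset (Fin h))
    (lam mu : Fin h → ℤ) (cu cw : ℤ)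
    (e : {i : Fin r // cu < ∑ a ∈ u i, lam a} ≃ {j : Fin r // cw < ∑ c ∈ w j, mu c})
    (e' : {i : Fin r // ¬ cu < ∑ a ∈ u i, lam a} ≃ {j : Fin r // ¬ cw < ∑ c ∈ w j, mu c})
    (f₁ f₂ : MvPolynomial (Fin (h + h)) ℂ)
    (hp : (Matrix.of fun i i' : {i : Fin r // cu < ∑ a ∈ u i, lam a} => MvPolynomial.coeff
        (∑ a ∈ u i.1, Finsupp.single (Fin.castAdd h a) 1 +
          ∑ c ∈ w (e i').1, Finsupp.single (Fin.natAdd h c) 1) f₁).det ≠ 0)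
    (hq : (Matrix.of fun i i' : {i : Fin r // ¬ cu < ∑ a ∈ u i, lam a} => MvPolynomial.coeff
        (∑ a ∈ u i.1, Finsupp.single (Fin.castAdd h a) 1 +
          ∑ c ∈ w (e' i').1, Finsupp.single (Fin.natAdd h c) 1) f₂).det ≠ 0) :
    ∃ f : MvPolynomial (Fin (h + h)) ℂ,
      f.totalDegree ≤ max f₁.totalDegree f₂.totalDegree ∧
      complexity f ≤ complexity f₁ + complexity f₂ + (h + h) + 3 ∧
      (Matrix.of fun i j : Fin r => MvPolynomial.coeff
        (∑ a ∈ u i, Finsupp.single (Fin.castAdd h a) 1 +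
          ∑ c ∈ w j, Finsupp.single (Fin.natAdd h c) 1) f).det ≠ 0 := by
  classical
  set rowv : Fin r → ℤ := fun i => ∑ a ∈ u i, lam a with hrowv
  set colv : Fin r → ℤ := fun j => ∑ c ∈ w j, mu c with hcolv
  set a : Fin r → ℤ := fun i => 2 * (rowv i - cu) - 1 with ha
  set b : Fin r → ℤ := fun j => 2 * (colv j - cw) - 1 with hb
  have ha_pos : ∀ i, 0 < a i ↔ cu < rowv i := fun i => by simp only [ha]; omega
  have hb_pos : ∀ j, 0 < b j ↔ cw < colv j := fun j => by simp only [hb]; omega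
  have ha_ne : ∀ i, a i ≠ 0 := fun i => by simp only [ha]; omega
  have hb_ne : ∀ j, b j ≠ 0 := fun j => by simp only [hb]; omega
  set Mb : ℤ := ∑ j, |b j| with hMb
  set L : ℤ := Mb + 1 with hL
  have hMb0 : 0 ≤ Mb := Finset.sum_nonneg fun j _ => abs_nonneg (b j)
  have hbMb : ∀ j, |b j| ≤ Mb := fun j => by
    have := Finset.single_le_sum (f := fun j => |b j|) (fun j _ => abs_nonneg (b j))
      (Finset.mem_univ j)
    simpa using this
  have hsign : ∀ i j, (0 < L * a i + b j ↔ 0 < a i) ∧ L * a i + b j ≠ 0 := by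
    intro i j
    have h1 := hbMb j
    have h3 := le_abs_self (b j)
    have h4 := neg_abs_le (b j)
    rcases lt_or_gt_of_ne (ha_ne i) with hneg | hpos
    · have h5 : L * a i ≤ -L := by nlinarith
      exact ⟨⟨fun hh => by omega, fun hh => by omega⟩, by omega⟩
    · have h5 : L ≤ L * a i := by nlinarith
      exact ⟨⟨fun _ => hpos, fun _ => by omega⟩, by omega⟩
  set Ma : ℤ := ∑ i, |a i| with hMa
  have hMa0 : 0 ≤ Ma := Finset.sum_nonneg fun i _ => abs_nonneg (a i)
  have haMa : ∀ i, |a i| ≤ Ma := fun i => by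
    have := Finset.single_le_sum (f := fun i => |a i|) (fun i _ => abs_nonneg (a i))
      (Finset.mem_univ i)
    simpa using this
  set C0 : ℤ := L * Ma + Mb with hC0
  have hC0_nonneg : 0 ≤ C0 := by nlinarith
  have hd_nonneg : ∀ i j, 0 ≤ C0 + L * a i + b j := by
    intro i j
    have h1 := haMa i; have h2 := hbMb j
    have h3 := neg_abs_le (a i); have h4 := neg_abs_le (b j)
    nlinarith
  set d : Fin r → Fin r → ℕ := fun i j => (C0 + L * a i + b j).toNat with hd
  set c₀ : ℕ := C0.toNat with hc₀
  have hd_cast : ∀ i j, ((d i j : ℕ) : ℤ) = C0 + L * a i + b j := fun i j =>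
    Int.toNat_of_nonneg (hd_nonneg i j)
  have hc₀_cast : ((c₀ : ℕ) : ℤ) = C0 := Int.toNat_of_nonneg hC0_nonneg
  set S : Finset (Fin r) := Finset.univ.filter (fun i => cu < rowv i) with hS
  set T : Finset (Fin r) := Finset.univ.filter (fun j => cw < colv j) with hT
  have hmemS : ∀ i, i ∈ S ↔ cu < rowv i := fun i => by simp [hS]
  have hmemT : ∀ j, j ∈ T ↔ cw < colv j := fun j => by simp [hT]
  have hK1 : ∀ i j, d i j ≠ c₀ := by
    intro i j hh
    apply (hsign i j).2
    have := congrArg (fun n : ℕ => (n : ℤ)) hh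
    simp only [hd_cast, hc₀_cast] at this
    linarith
  have hK2 : ∀ i j, c₀ < d i j ↔ i ∈ S := by
    intro i j
    rw [hmemS, ← ha_pos, ← (hsign i j).1, ← Nat.cast_lt (α := ℤ), hd_cast, hc₀_cast]
    constructor <;> intro hh <;> linarith
  have htop : ∀ i j, ((max (d i j) c₀ : ℕ) : ℤ) = C0 + (if i ∈ S then L * a i + b j else 0) := by
    intro i j
    rw [Nat.cast_max, hd_cast, hc₀_cast]
    by_cases hi : i ∈ S
    · have := ((hsign i j).1).mpr ((ha_pos i).mpr ((hmemS i).mp hi))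
      rw [if_pos hi, max_eq_left (by linarith)]
      ring
    · have : ¬ 0 < L * a i + b j :=
        fun hh => hi ((hmemS i).mpr ((ha_pos i).mp (((hsign i j).1).mp hh)))
      rw [if_neg hi, add_zero, max_eq_right (by linarith)]
  have hsum : ∀ σ : Equiv.Perm (Fin r), ((∑ j, max (d (σ j) j) c₀ : ℕ) : ℤ) =
      r * C0 + L * (∑ i, if i ∈ S then a i else 0) + ∑ j, (if σ j ∈ S then b j else 0) := by
    intro σ
    rw [Nat.cast_sum]
    simp_rw [htop]
    rw [Finset.sum_add_distrib, Finset.sum_const, Finset.card_univ, Fintype.card_fin,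
      nsmul_eq_mul]
    have hsplit : ∀ j, (if σ j ∈ S then L * a (σ j) + b j else 0) =
        L * (if σ j ∈ S then a (σ j) else 0) + (if σ j ∈ S then b j else 0) := fun j => by
      by_cases hj : σ j ∈ S
      · rw [if_pos hj, if_pos hj, if_pos hj]
      · rw [if_neg hj, if_neg hj, if_neg hj, mul_zero, add_zero]
    simp_rw [hsplit]
    rw [Finset.sum_add_distrib, ← Finset.mul_sum,
      Fintype.sum_equiv σ (fun j => if σ j ∈ S then a (σ j) else 0)
        (fun i => if i ∈ S then a i else 0) (fun j => rfl)]
    ring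
  have hB_le : ∀ σ : Equiv.Perm (Fin r),
      (∑ j, (if σ j ∈ S then b j else 0)) ≤ ∑ j, (if j ∈ T then b j else 0) := fun σ =>
    Finset.sum_le_sum fun j _ =>
      (ite_le_ite_of_sign (b j) (hb_ne j) ((hb_pos j).trans (hmemT j).symm)).1
  have hB_eq : ∀ σ : Equiv.Perm (Fin r), (∀ j, σ j ∈ S ↔ j ∈ T) →
      (∑ j, (if σ j ∈ S then b j else 0)) = ∑ j, (if j ∈ T then b j else 0) := fun σ hσ =>
    Finset.sum_congr rfl fun j _ =>
      ((ite_le_ite_of_sign (b j) (hb_ne j) ((hb_pos j).trans (hmemT j).symm)).2).mpr (hσ j)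
  have hB_lt : ∀ σ : Equiv.Perm (Fin r), ¬ (∀ j, σ j ∈ S ↔ j ∈ T) →
      (∑ j, (if σ j ∈ S then b j else 0)) < ∑ j, (if j ∈ T then b j else 0) := fun σ hσ => by
    obtain ⟨j₀, hj₀⟩ := not_forall.mp hσ
    have key := ite_le_ite_of_sign (S := σ j₀ ∈ S) (b j₀) (hb_ne j₀)
      ((hb_pos j₀).trans (hmemT j₀).symm)
    exact Finset.sum_lt_sum (fun j _ =>
      (ite_le_ite_of_sign (b j) (hb_ne j) ((hb_pos j).trans (hmemT j).symm)).1)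
      ⟨j₀, Finset.mem_univ _, lt_of_le_of_ne key.1 (fun hh => hj₀ (key.2.mp hh))⟩
  set NZ : ℤ := r * C0 + L * (∑ i, if i ∈ S then a i else 0) + ∑ j, (if j ∈ T then b j else 0)
    with hNZ
  have hNZ_nonneg : 0 ≤ NZ := by
    have h0 : (0 : ℤ) ≤ ((∑ j, max (d ((1 : Equiv.Perm (Fin r)) j) j) c₀ : ℕ) : ℤ) :=
      Nat.cast_nonneg _
    rw [hsum 1] at h0
    have := hB_le 1
    linarith
  set N : ℕ := NZ.toNat with hN
  have hN_cast : ((N : ℕ) : ℤ) = NZ := Int.toNat_of_nonneg hNZ_nonneg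
  have htop_eq : ∀ σ : Equiv.Perm (Fin r), (∀ j, σ j ∈ S ↔ j ∈ T) →
      ∑ j, max (d (σ j) j) c₀ = N := fun σ hσ => by
    have h1 := hsum σ
    rw [hB_eq σ hσ] at h1
    exact_mod_cast h1.trans hN_cast.symm
  have htop_lt : ∀ σ : Equiv.Perm (Fin r), ¬ (∀ j, σ j ∈ S ↔ j ∈ T) →
      ∑ j, max (d (σ j) j) c₀ < N := fun σ hσ => by
    have h1 := hsum σ
    have h2 := hB_lt σ hσ
    have : ((∑ j, max (d (σ j) j) c₀ : ℕ) : ℤ) < (N : ℤ) := by rw [h1, hN_cast]; linarith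
    exact_mod_cast this
  set p : Matrix (Fin r) (Fin r) ℂ := Matrix.of fun i j => MvPolynomial.coeff
    (∑ a ∈ u i, Finsupp.single (Fin.castAdd h a) 1 + ∑ c ∈ w j, Finsupp.single (Fin.natAdd h c) 1) f₁
    with hpdef
  set q : Matrix (Fin r) (Fin r) ℂ := Matrix.of fun i j => MvPolynomial.coeff
    (∑ a ∈ u i, Finsupp.single (Fin.castAdd h a) 1 + ∑ c ∈ w j, Finsupp.single (Fin.natAdd h c) 1) f₂
    with hqdef
  let φS : {i : Fin r // cu < rowv i} ≃ {i // i ∈ S} :=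
    Equiv.subtypeEquivRight (fun i => (hmemS i).symm)
  let φT : {j : Fin r // cw < colv j} ≃ {j // j ∈ T} :=
    Equiv.subtypeEquivRight (fun j => (hmemT j).symm)
  let φS' : {i : Fin r // ¬ cu < rowv i} ≃ {i // i ∉ S} :=
    Equiv.subtypeEquivRight (fun i => by rw [hmemS])
  let φT' : {j : Fin r // ¬ cw < colv j} ≃ {j // j ∉ T} :=
    Equiv.subtypeEquivRight (fun j => by rw [hmemT])
  let eS : {i // i ∈ S} ≃ {j // j ∈ T} := φS.symm.trans (e.trans φT)
  let eS' : {i // i ∉ S} ≃ {j // j ∉ T} := φS'.symm.trans (e'.trans φT')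
  have hp' : (Matrix.of fun i i' : {i // i ∈ S} => p i (eS i')).det ≠ 0 := by
    have hre : (Matrix.of fun i i' : {i // i ∈ S} => p i (eS i')) =
        (Matrix.of fun i i' : {i : Fin r // cu < rowv i} => MvPolynomial.coeff
          (∑ a ∈ u i.1, Finsupp.single (Fin.castAdd h a) 1 +
            ∑ c ∈ w (e i').1, Finsupp.single (Fin.natAdd h c) 1) f₁).reindex φS φS := by
      ext i i'
      rfl
    rw [hre, Matrix.det_reindex_self]
    exact hp
  have hq' : (Matrix.of fun i i' : {i // i ∉ S} => q i (eS' i')).det ≠ 0 := by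
    have hre : (Matrix.of fun i i' : {i // i ∉ S} => q i (eS' i')) =
        (Matrix.of fun i i' : {i : Fin r // ¬ cu < rowv i} => MvPolynomial.coeff
          (∑ a ∈ u i.1, Finsupp.single (Fin.castAdd h a) 1 +
            ∑ c ∈ w (e' i').1, Finsupp.single (Fin.natAdd h c) 1) f₂).reindex φS' φS' := by
      ext i i'
      rfl
    rw [hre, Matrix.det_reindex_self]
    exact hq
  have hG := det_fromBlocks_of_split_ne_zero p q S T eS eS' hp' hq'
  have hA := det_ne_zero_of_twoBlock p q d c₀ S T hK1 hK2 N htop_eq htop_lt hG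
  set A : Matrix (Fin r) (Fin r) (Polynomial ℂ) := Matrix.of fun i j : Fin r =>
    Polynomial.C (p i j) * Polynomial.X ^ d i j + Polynomial.C (q i j) * Polynomial.X ^ c₀ with hAdef
  have hD : (Polynomial.X * A.det) ≠ 0 := mul_ne_zero Polynomial.X_ne_zero hA
  obtain ⟨x₀, hx₀⟩ := Infinite.exists_notMem_finset (Polynomial.X * A.det).roots.toFinset
  rw [Multiset.mem_toFinset, Polynomial.mem_roots hD, Polynomial.IsRoot.def, Polynomial.eval_mul,
    Polynomial.eval_X, mul_eq_zero, not_or] at hx₀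
  obtain ⟨hx₀ne, hdetx⟩ := hx₀
  have hevaldet : Polynomial.eval x₀ A.det =
      (Matrix.of fun i j : Fin r => p i j * x₀ ^ d i j + q i j * x₀ ^ c₀).det := by
    rw [← Polynomial.coe_evalRingHom, RingHom.map_det]
    congr 1
    ext i j
    simp [hAdef, RingHom.mapMatrix_apply, Matrix.map_apply]
  set K : ℤ := C0 - 2 * L * cu - L - 2 * cw - 1 with hK
  have hdZ : ∀ i j, ((d i j : ℕ) : ℤ) = K + (∑ a ∈ u i, 2 * L * lam a) + ∑ c ∈ w j, 2 * mu c := by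
    intro i j
    have h1 : (∑ a ∈ u i, 2 * L * lam a) = 2 * L * rowv i := by
      rw [hrowv, Finset.mul_sum]
    have h2 : (∑ c ∈ w j, 2 * mu c) = 2 * colv j := by
      rw [hcolv, Finset.mul_sum]
    rw [h1, h2, hd_cast, hK, ha, hb]
    ring
  set s : Fin (h + h) → ℂ := fun i => Fin.addCases (fun a => x₀ ^ (2 * L * lam a))
    (fun c => x₀ ^ (2 * mu c)) i with hs
  have hs_cast : ∀ a : Fin h, s (Fin.castAdd h a) = x₀ ^ (2 * L * lam a) := fun a =>
    Fin.addCases_left _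
  have hs_nat : ∀ c : Fin h, s (Fin.natAdd h c) = x₀ ^ (2 * mu c) := fun c =>
    Fin.addCases_right _
  set g₁ : MvPolynomial (Fin (h + h)) ℂ := ∑ dd ∈ f₁.support, MvPolynomial.monomial dd
      (MvPolynomial.coeff dd f₁ * ∏ i ∈ dd.support, s i ^ dd i) with hg₁
  set f : MvPolynomial (Fin (h + h)) ℂ := MvPolynomial.C (x₀ ^ K) * g₁ + MvPolynomial.C (x₀ ^ c₀) * f₂
    with hf
  refine ⟨f, ?_, ?_, ?_⟩
  · -- degree
    refine (MvPolynomial.totalDegree_add _ _).trans (max_le ?_ ?_)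
    · exact (MvPolynomial.totalDegree_mul _ _).trans (by
        rw [MvPolynomial.totalDegree_C, zero_add]
        exact (totalDegree_rescale_le s f₁).trans (le_max_left _ _))
    · exact (MvPolynomial.totalDegree_mul _ _).trans (by
        rw [MvPolynomial.totalDegree_C, zero_add]; exact le_max_right _ _)
  · -- size: additive
    calc complexity f ≤ complexity (MvPolynomial.C (x₀ ^ K) * g₁) +
          complexity (MvPolynomial.C (x₀ ^ c₀) * f₂) + 1 := complexity_add_le_holds _ _
      _ ≤ (0 + (complexity f₁ + (h + h)) + 1) + (0 + complexity f₂ + 1) + 1 := by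
          gcongr
          · refine (complexity_mul_le_holds _ _).trans ?_
            gcongr
            · exact (complexity_C_holds _).le
            · exact complexity_rescale_le s f₁
          · refine (complexity_mul_le_holds _ _).trans ?_
            gcongr
            exact (complexity_C_holds _).le
      _ = complexity f₁ + complexity f₂ + (h + h) + 3 := by ring
  · -- the layout minor of f is the evaluated tropical matrix
    have hcoef : ∀ i j : Fin r, MvPolynomial.coeff
        (∑ a ∈ u i, Finsupp.single (Fin.castAdd h a) 1 + ∑ c ∈ w j, Finsupp.single (Fin.natAdd h c) 1)
        f = p i j * x₀ ^ d i j + q i j * x₀ ^ c₀ := by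
      intro i j
      rw [hf, MvPolynomial.coeff_add, MvPolynomial.coeff_C_mul, MvPolynomial.coeff_C_mul, hg₁,
        coeff_rescale, rescale_factor_partition]
      simp_rw [hs_cast, hs_nat]
      rw [prod_ite_zpow x₀ hx₀ne, prod_ite_zpow x₀ hx₀ne, hpdef, hqdef, Matrix.of_apply,
        Matrix.of_apply]
      have hpow : x₀ ^ K * (x₀ ^ (∑ a ∈ u i, 2 * L * lam a) * x₀ ^ (∑ c ∈ w j, 2 * mu c)) =
          x₀ ^ (d i j) := by
        rw [← zpow_natCast, hdZ, zpow_add₀ hx₀ne, zpow_add₀ hx₀ne]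
        ring
      rw [← hpow]
      ring
    have hM : (Matrix.of fun i j : Fin r => MvPolynomial.coeff
        (∑ a ∈ u i, Finsupp.single (Fin.castAdd h a) 1 + ∑ c ∈ w j, Finsupp.single (Fin.natAdd h c) 1)
        f) = Matrix.of fun i j : Fin r => p i j * x₀ ^ d i j + q i j * x₀ ^ c₀ := by
      ext i j
      rw [Matrix.of_apply, Matrix.of_apply, hcoef]
    rw [hM, ← hevaldet]
    exact hdetx

end Summit.ValiantsHypothesis.ValiantsHypothesis.Theorems.BarrierLever.SplitDoor
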